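import Summits.RiemannHypothesis.RiemannHypothesis.Theses.WeilWindowFlow
import Literature.NumberTheory.LFunctions.WeilGroundState

/-!
# `GronwallLeakage` (crux stmt-RiemannHypothesis-1037, route WeilWindowFlow) — load-bearing analysis

Negative lemmas for the crux
`X := ∃ C, ∀ b a, 0 < b → b ≤ a → IntervalIntegrable C volume b a ∧ ε b * exp (-(∫ x in b..a, C x)) ≤ ε a`,
`ε = Literature.NumberTheory.LFunctions.weilGroundEnergy` (refuter's standing-adversary output, cdisprove
cycle 1; all variants stated INLINE, no new definitions). Everything rests on the PROVED coercivity
`weilQuadratic_coercive` (Bombieri 2000, Thm 12): `ε(b) → +∞` as `b → 0⁺`.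

* `leakage_integral_unbounded_at_zero` — CORE: for no rate `C` obeying the two-window law can
  `b ↦ ∫_b^a C` stay bounded above as `b → 0⁺`;
* `gronwallLeakage_rate_not_intervalIntegrable_from_zero` — TIGHTNESS AT `0⁺`: an admissible rate is never
  integrable on `[0, a]` ("any proof must let `∫_0 C = +∞`");
* `gronwallLeakage_rate_unbounded_above_near_zero` — the rate is unbounded above on every `(0, a]`;
* `gronwallLeakage_false_without_posB` — LOAD-BEARING `0 < b`: the variant of `X` quantifying over
  `0 ≤ b` (law + integrability from the degenerate window `b = 0`, where `ε 0 = sInf ∅ = 0`) is FALSE;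
* `gronwallLeakage_false_with_const_rate`, `gronwallLeakage_false_with_bounded_rate` — the natural
  strengthenings "uniform exponential leakage `ε(a) ≥ ε(b) e^{-K(a-b)}`" and "rate bounded above on (0,1]"
  are FALSE;
* `windowBottom_not_lipschitz_down_to_zero` — no one-sided Lipschitz bound `ε(b) - ε(a) ≤ L (a - b)` on
  `0 < b ≤ a` (the floor `0 < b₀` of the sibling cruxes `WindowLipschitz` / `DiniLeakage` is load-bearing;
  cf. the crux-1039 disprover's `windowLipschitz_false_without_floor`).

* `weilGroundEnergy_zero`, `leakageLaw_from_zero_iff_riemannHypothesis` — the degenerate window has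
  `ε 0 = sInf ∅ = 0`, and the `b = 0` instance of the law ALONE is exactly RH (Yoshida's criterion);
* `exists_weilGroundEnergy_neg_of_not_riemannHypothesis` — calibration: ¬RH ⟹ a conjugate point
  (`ε(a) < 0` at a finite window), the first disjunct of `¬X`.

Helpers: `sphereValues_nonempty`, `weilGroundEnergy_antitone_of_pos` (ε antitone on (0,∞)),
`weilGroundEnergy_unbounded_near_zero`. Axioms ⊆ {propext, Classical.choice, Quot.sound}.
-/

noncomputable section

open MeasureTheory Set Filter

namespace Summit.RiemannHypothesis.Cruxes.GronwallLeakage.Negative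

open Literature.NumberTheory.LFunctions
open Summit.RiemannHypothesis.RiemannHypothesis.Theses.WeilWindowFlow

/-- The set of values `Re Q(g)` on the unit `L²`-sphere of the window `[-a, a]`, `a > 0`, is nonempty
(`exists_isWeilTest_sphere`). [folklore] -/
theorem sphereValues_nonempty {a : ℝ} (ha : 0 < a) :
    {x : ℝ | ∃ g : ℝ → ℂ, IsWeilTest g ∧ tsupport g ⊆ Icc (-a) a ∧
      ∫ t : ℝ, ‖g t‖ ^ 2 = 1 ∧ x = (weilQuadratic g).re}.Nonempty := by
  obtain ⟨g, hg, hsupp, hnorm⟩ := exists_isWeilTest_sphere ha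
  exact ⟨_, g, hg, hsupp, hnorm, rfl⟩

/-- `ε` is antitone on `(0, ∞)`: a larger window admits more test functions (`csInf_le_csInf` with
`bddBelow_weilQuadratic_sphere_holds`). [folklore] -/
theorem weilGroundEnergy_antitone_of_pos {b a : ℝ} (hb : 0 < b) (hba : b ≤ a) :
    weilGroundEnergy a ≤ weilGroundEnergy b := by
  refine csInf_le_csInf (bddBelow_weilQuadratic_sphere_holds a) (sphereValues_nonempty hb) ?_
  rintro x ⟨g, hg, hsupp, hnorm, rfl⟩
  exact ⟨g, hg, hsupp.trans (Icc_subset_Icc (by linarith) hba), hnorm, rfl⟩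

/-- Coercive blow-up at `0⁺`: for every level `A` there is `a₀ > 0` with `A ≤ ε(a)` for all
`0 < a ≤ a₀` (`weilQuadratic_coercive A`, Bombieri 2000 Thm 12, and `le_csInf`).
[cite: Bombieri2000Weil, §12 Thm. 12, corollary] -/
theorem weilGroundEnergy_unbounded_near_zero (A : ℝ) :
    ∃ a₀ : ℝ, 0 < a₀ ∧ ∀ a : ℝ, 0 < a → a ≤ a₀ → A ≤ weilGroundEnergy a := by
  obtain ⟨a₀, ha₀, H⟩ := weilQuadratic_coercive A
  refine ⟨a₀, ha₀, fun a ha hale ↦ le_csInf (sphereValues_nonempty ha) ?_⟩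
  rintro x ⟨g, hg, hsupp, hnorm, rfl⟩
  have h := H a ha hale g hg hsupp
  rwa [hnorm, mul_one] at h

/-- The degenerate window: `ε 0 = sInf ∅ = 0` (a test function with `tsupport ⊆ {0}` vanishes a.e.,
so it cannot have unit `L²` norm). [folklore] -/
theorem weilGroundEnergy_zero : weilGroundEnergy 0 = 0 := by
  have hempty : {x : ℝ | ∃ g : ℝ → ℂ, IsWeilTest g ∧ tsupport g ⊆ Icc (-0) 0 ∧
      ∫ t : ℝ, ‖g t‖ ^ 2 = 1 ∧ x = (weilQuadratic g).re} = ∅ := by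
    ext x
    simp only [mem_setOf_eq, mem_empty_iff_false, iff_false]
    rintro ⟨g, -, hsupp, hnorm, -⟩
    have h0 : ∀ᵐ t : ℝ ∂volume, t ∉ ({0} : Set ℝ) :=
      measure_eq_zero_iff_ae_notMem.1 (measure_singleton 0)
    have hae : (fun t ↦ ‖g t‖ ^ 2) =ᵐ[volume] fun _ ↦ (0 : ℝ) := by
      filter_upwards [h0] with t ht
      have hgt : g t = 0 := image_eq_zero_of_notMem_tsupport fun h ↦ ht (by simpa using hsupp h)
      simp [hgt]
    rw [integral_congr_ae hae] at hnorm
    simp at hnorm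
  show sInf _ = 0
  rw [hempty, Real.sInf_empty]

/-- The `b = 0` instance of the leakage law alone (`ε 0 · e^{…} ≤ ε a`, i.e. `0 ≤ ε a` for all `a > 0`)
is exactly the Riemann hypothesis (`weilGroundEnergy_nonneg_iff_holds`, Yoshida's criterion
`riemannHypothesis_iff_forall_weilPositivityOn`): the degenerate endpoint carries RH, while demanding
integrability of the rate from `0` is refutable (`gronwallLeakage_false_without_posB`). [folklore] -/
theorem leakageLaw_from_zero_iff_riemannHypothesis (C : ℝ → ℝ) :
    (∀ a : ℝ, 0 < a →
        weilGroundEnergy 0 * Real.exp (-(∫ x in (0 : ℝ)..a, C x)) ≤ weilGroundEnergy a) ↔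
      _root_.RiemannHypothesis := by
  simp only [weilGroundEnergy_zero, zero_mul]
  rw [riemannHypothesis_iff_forall_weilPositivityOn]
  exact forall₂_congr fun a ha ↦ weilGroundEnergy_nonneg_iff_holds ha

/-- ¬RH BRANCH of the tightness at `+∞`: if RH fails, the window flow meets a conjugate point at a
finite window — some `ε(a) < 0` (Yoshida's criterion `riemannHypothesis_iff_forall_weilPositivityOn`
and `weilGroundEnergy_nonneg_iff_holds`); then no rate whatsoever transports positivity past `a`.
[folklore] -/
theorem exists_weilGroundEnergy_neg_of_not_riemannHypothesis (h : ¬ _root_.RiemannHypothesis) :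
    ∃ a : ℝ, 0 < a ∧ weilGroundEnergy a < 0 := by
  rw [riemannHypothesis_iff_forall_weilPositivityOn] at h
  push Not at h
  obtain ⟨a, ha, hna⟩ := h
  exact ⟨a, ha, lt_of_not_ge fun h0 ↦ hna ((weilGroundEnergy_nonneg_iff_holds ha).1 h0)⟩

/-- CORE BLOW-UP LEMMA. If a rate `C` obeys the two-window leakage law
`ε b * exp (-(∫ x in b..a, C x)) ≤ ε a` for `0 < b ≤ a`, then `b ↦ ∫_b^a C` is NOT bounded above on
`(0, a]`: otherwise `ε(b) ≤ |ε(a)| e^{M}` for all small `b`, against `ε(b) → +∞`. [folklore] -/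
theorem leakage_integral_unbounded_at_zero {C : ℝ → ℝ}
    (hC : ∀ b a : ℝ, 0 < b → b ≤ a →
      weilGroundEnergy b * Real.exp (-(∫ x in b..a, C x)) ≤ weilGroundEnergy a)
    {a : ℝ} (ha : 0 < a) (M : ℝ) (hM : ∀ b : ℝ, 0 < b → b ≤ a → ∫ x in b..a, C x ≤ M) : False := by
  obtain ⟨a₀, ha₀, hcoer⟩ :=
    weilGroundEnergy_unbounded_near_zero (|weilGroundEnergy a| * Real.exp M + 1)
  set b : ℝ := min a₀ a with hb
  have hb0 : 0 < b := lt_min ha₀ ha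
  have hba : b ≤ a := min_le_right _ _
  have hεb : |weilGroundEnergy a| * Real.exp M + 1 ≤ weilGroundEnergy b :=
    hcoer b hb0 (min_le_left _ _)
  have hnn : 0 ≤ |weilGroundEnergy a| * Real.exp M := by positivity
  have hεb0 : 0 ≤ weilGroundEnergy b := by linarith
  have hexp : Real.exp (-M) ≤ Real.exp (-(∫ x in b..a, C x)) :=
    Real.exp_le_exp.2 (by linarith [hM b hb0 hba])
  have h1 : weilGroundEnergy b * Real.exp (-M) ≤ |weilGroundEnergy a| :=
    ((mul_le_mul_of_nonneg_left hexp hεb0).trans (hC b a hb0 hba)).trans (le_abs_self _)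
  have h2 : weilGroundEnergy b ≤ |weilGroundEnergy a| * Real.exp M := by
    have h4 : weilGroundEnergy b = weilGroundEnergy b * Real.exp (-M) * Real.exp M := by
      rw [mul_assoc, ← Real.exp_add, neg_add_cancel, Real.exp_zero, mul_one]
    rw [h4]
    exact mul_le_mul_of_nonneg_right h1 (Real.exp_pos M).le
  linarith

/-- TIGHTNESS AT `0⁺`. A rate obeying the two-window law is never integrable on `[0, a]`, `a > 0`:
the Grönwall integral `∫_b^a C` diverges as `b → 0⁺` (at least like `log ε(b)`). So in any proof of
`X` the rate `C` lies in `L¹_loc(0, ∞) \ L¹(0, 1)`. [folklore] -/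
theorem gronwallLeakage_rate_not_intervalIntegrable_from_zero {C : ℝ → ℝ}
    (hC : ∀ b a : ℝ, 0 < b → b ≤ a →
      weilGroundEnergy b * Real.exp (-(∫ x in b..a, C x)) ≤ weilGroundEnergy a)
    {a : ℝ} (ha : 0 < a) : ¬ IntervalIntegrable C volume 0 a := by
  intro hint
  refine leakage_integral_unbounded_at_zero hC ha (∫ x in (0 : ℝ)..a, |C x|) fun b hb hba ↦ ?_
  calc ∫ x in b..a, C x ≤ |∫ x in b..a, C x| := le_abs_self _
    _ ≤ ∫ x in b..a, |C x| := intervalIntegral.abs_integral_le_integral_abs hba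
    _ ≤ ∫ x in (0 : ℝ)..a, |C x| :=
        intervalIntegral.integral_mono_interval hb.le hba le_rfl
          (Eventually.of_forall fun x ↦ abs_nonneg (C x)) hint.abs

/-- The rate of any witness of `X` is UNBOUNDED ABOVE on every `(0, a]`: for every `M` some
`x ∈ (0, a]` has `M < C x`. [folklore] -/
theorem gronwallLeakage_rate_unbounded_above_near_zero {C : ℝ → ℝ}
    (hC : ∀ b a : ℝ, 0 < b → b ≤ a → IntervalIntegrable C volume b a ∧
      weilGroundEnergy b * Real.exp (-(∫ x in b..a, C x)) ≤ weilGroundEnergy a)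
    {a : ℝ} (ha : 0 < a) (M : ℝ) : ∃ x : ℝ, 0 < x ∧ x ≤ a ∧ M < C x := by
  by_contra h
  push Not at h
  refine leakage_integral_unbounded_at_zero (fun b a hb hba ↦ (hC b a hb hba).2) ha (|M| * a)
    fun b hb hba ↦ ?_
  calc ∫ x in b..a, C x ≤ ∫ x in b..a, (fun _ ↦ |M|) x :=
        intervalIntegral.integral_mono_on hba (hC b a hb hba).1 intervalIntegrable_const
          fun x hx ↦ (h x (hb.trans_le hx.1) hx.2).trans (le_abs_self M)
    _ = |M| * (a - b) := by simp [mul_comm]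
    _ ≤ |M| * a := by nlinarith [abs_nonneg M, hb.le]

/-- LOAD-BEARING `0 < b`. `X` with its side condition weakened to `0 ≤ b` — so that the law and the
integrability of the rate are also demanded from the degenerate window `b = 0` (`ε 0 = sInf ∅ = 0`) —
is FALSE: the rate would be integrable on `[0, 1]`. [folklore] -/
theorem gronwallLeakage_false_without_posB :
    ¬ ∃ C : ℝ → ℝ, ∀ b a : ℝ, 0 ≤ b → b ≤ a → IntervalIntegrable C volume b a ∧
        weilGroundEnergy b * Real.exp (-(∫ x in b..a, C x)) ≤ weilGroundEnergy a := by
  rintro ⟨C, hC⟩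
  exact gronwallLeakage_rate_not_intervalIntegrable_from_zero (fun b a hb hba ↦ (hC b a hb.le hba).2)
    one_pos (hC 0 1 le_rfl zero_le_one).1

/-- REFUTED STRENGTHENING (uniform exponential leakage): there is no constant rate `K` with
`ε(a) ≥ ε(b) e^{-K (a - b)}` for all `0 < b ≤ a`. The content of `X` is in the blow-up of `C` at `0⁺`
(and, conjecturally, `C(a) ~ c e^{2a}` at `+∞`, arXiv:2106.01715 §2.5). [folklore] -/
theorem gronwallLeakage_false_with_const_rate :
    ¬ ∃ K : ℝ, ∀ b a : ℝ, 0 < b → b ≤ a →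
        weilGroundEnergy b * Real.exp (-(K * (a - b))) ≤ weilGroundEnergy a := by
  rintro ⟨K, hK⟩
  refine gronwallLeakage_rate_not_intervalIntegrable_from_zero (C := fun _ ↦ K) ?_ one_pos
    intervalIntegrable_const
  intro b a hb hba
  have e : (∫ x in b..a, (fun _ : ℝ ↦ K) x) = K * (a - b) := by
    simp only [intervalIntegral.integral_const, smul_eq_mul]; ring
  rw [e]
  exact hK b a hb hba

/-- REFUTED STRENGTHENING (rate bounded above near `0`): no witness of `X` has its rate bounded above
on `(0, 1]`. [folklore] -/
theorem gronwallLeakage_false_with_bounded_rate :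
    ¬ ∃ C : ℝ → ℝ, (∃ M : ℝ, ∀ x : ℝ, 0 < x → x ≤ 1 → C x ≤ M) ∧
        ∀ b a : ℝ, 0 < b → b ≤ a → IntervalIntegrable C volume b a ∧
          weilGroundEnergy b * Real.exp (-(∫ x in b..a, C x)) ≤ weilGroundEnergy a := by
  rintro ⟨C, ⟨M, hM⟩, hC⟩
  obtain ⟨x, hx0, hx1, hMx⟩ := gronwallLeakage_rate_unbounded_above_near_zero hC one_pos M
  exact (lt_irrefl M) (hMx.trans_le (hM x hx0 hx1))

/-- No one-sided Lipschitz bound for the window bottom down to `b = 0`: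
`¬ ∃ L, ∀ 0 < b ≤ a, ε(b) - ε(a) ≤ L (a - b)` (`ε(b) → +∞` while `ε(1)` is finite). The floor `0 < b₀`
of the sibling cruxes `WindowLipschitz` and `DiniLeakage` is load-bearing. [folklore] -/
theorem windowBottom_not_lipschitz_down_to_zero :
    ¬ ∃ L : ℝ, ∀ b a : ℝ, 0 < b → b ≤ a →
        weilGroundEnergy b - weilGroundEnergy a ≤ L * (a - b) := by
  rintro ⟨L, hL⟩
  obtain ⟨a₀, ha₀, hcoer⟩ :=
    weilGroundEnergy_unbounded_near_zero (weilGroundEnergy 1 + |L| + 1)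
  set b : ℝ := min a₀ 1 with hb
  have hb0 : 0 < b := lt_min ha₀ one_pos
  have hb1 : b ≤ 1 := min_le_right _ _
  have h1 := hL b 1 hb0 hb1
  have h2 := hcoer b hb0 (min_le_left _ _)
  have h3 : L * (1 - b) ≤ |L| := by
    have : L * (1 - b) ≤ |L| * (1 - b) :=
      mul_le_mul_of_nonneg_right (le_abs_self L) (by linarith)
    nlinarith [abs_nonneg L, hb0.le]
  linarith

end Summit.RiemannHypothesis.Cruxes.GronwallLeakage.Negative

end
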